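import Summits.QuantumFields.BalabanUV.Beta.SymRootedMixedJetContact
import Summits.QuantumFields.BalabanUV.Beta.SymRootedMixedJetSigns
import Summits.QuantumFields.BalabanUV.Beta.RootedMixedJetSingle

/-!
# `BalabanUV.Beta.SymRootedMixedJetSingle` — THE AXIS-REFLECTION LAW OF THE (0.4)-SYMMETRISED ROOTED MIXED JET `symMjetAt` AT SINGLE LETTERS, IN SYM COUNTS
# (β sub-cell, row D1, TABLES-SYM-LEAN S2c, INTERFACE-LEVEL twin of an3's `RootedMixedJetSingle` §2–§4; an1 gen 43; the mixed path to (T2-M₂))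

HONEST FRAMING (cell charter, verbatim): «discharging BetaPertH makes Bałaban's UV stability UNCONDITIONAL — a real
constructive-QFT result; it is NOT the continuum limit and NOT the Clay problem.»  HONEST DEPENDENCY (verbatim): «continuum YM on
T⁴ ⇐ BetaPertH ∧ nine spine estimates (0/9 proved); BetaPertH ⇐ (D1) ∧ (D4) ∧ CAP+tail; G-an2-4 gates asym, D1 and NE2/3/4.»
ABSOLUTE RULE (R-g25-7 ∕ R-D1-g30-1 (A)): the (0.4)-symmetrised averaging is the exp of the MEAN OF LOGS over the pair family
`{loop^{σ,σ′}}` with weight `((d!)²·L^d)⁻¹`; every object below is the comb module's algebra read on an1's `symPhiGAt` (S2b part 1)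
instead of `PhiGAt` — STATEMENT FOR STATEMENT under the dictionary `PhiXAt ↦ symPhiXAt`, `XjetAt ↦ symXjetAt`, `MσXAt ↦ symMσXAt`,
`L^{-d}·linAvgAt ↦ (d!·L^d)⁻¹·symLinU`, `L^{-d}·hessUAt ↦ ((d!)²L^d)⁻¹·symHessUAt`, `L^{-2d}·vhUAt ↦ ((d!)²L^{2d})⁻¹·symVhUAt`
(an3-g63 [AN3-G63-S2C] (C-ii): constants PER BCH ORDER; CONVENTION `(d!)²` un-normalised inside order-2 sym functionals).
FAMILY-INDEPENDENT chart ∕ letter ∕ `Tau`-algebra lemmas of the comb module are imported BY NAME, never re-proved.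
DERIVED cell leaf: [folklore] ring algebra; the `sym*` families are [our object]s.  No statement of Bałaban's papers is typed here, no
`[cite:]` tag, no `Prop` is minted, no binder of the β-function wall (`hW`/`hR`/`D1Tel`/`D1Rep`, (D1), `BetaPertH`) is instantiated or
discharged; nothing about the VALUES of `symMixFFAt`∕`symVh₂SAt` and no (T2-B)∕(T2-M₂) letter is discharged in this file.
NOT D1, NOT BetaPertH, NOT continuum, NOT Clay.  NOT summit progress.
Provenance: β sub-cell, TABLES-SYM-LEAN S2c option (C) (S2C-SCOPE-v1 94facb80ac685517), unit b2b-balaban-beta-an1-g43 (W-supplier AN1,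
FREEZE (0): scratch for a courier; an1 files nothing), 2026-08-21; no existing file touched.

## What this module proves (sym twin of `RootedMixedJetSingle`; §1 `D1R_of_single`∕`D2R_of_single`∕`D12R_of_single`, the sign lemmas `single_neg`∕`ite_neg_eq_zsmul`,
## the cubic contact letter `sym3`∕`sym3_zsmul` are family-independent, the comb module's BY NAME; `ρ_c = ctr d L`, `L` odd, `(L : 𝕜) ≠ 0`, `(2 : 𝕜) ≠ 0`, `(d! : 𝕜) ≠ 0` in §4)
CONSTANTS (an3's CONVENTION, INBOX l.10554): the sym functionals are normalised by `(d!)²·L^d` at second BCH order and `d!·L^d` at first, and an1's sym counts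
`symHessCountAt = 2(d!)²L^d · h_sym`, `symLinCountAt = d!·L^d · q_sym` (`SymAveragingHessianCountsWords`, landed) replace node 7aρ's `hessCountAt`, `linCountAt`.
* §2 THE SYM CONTACT FUNCTIONALS AT SINGLE LETTERS IN SYM COUNTS (`contact_single`, `lin_single_ite`, `comm_hess_lin_single`):
  `s • (symHessUAt ρ (single F₁ u) (single F₂ x) + d! • symLinU ρ [single F₁ u, single F₂ x]) = s • ((symHessCountAt ρ F₁ F₂ + [F₁ = F₂]·d!·symLinCountAt ρ F₁) • [u, x])`,
  `[s • symHessUAt ρ (single F a) (single F′ b), t • symLinU ρ (single G c)] = (s t) • ((symHessCountAt ρ F F′ · symLinCountAt ρ G) • [[a,b],c])`.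
* §3 `symMjetAt_single_signs` (an1's `symMjetAt_neg_W`∕`_V`∕`_B`).
* §4 **`symMjetAt_bref_of_single`**, **`symMjetAt_single_bref`**: the comb law verbatim with `(2L^d)⁻¹ ↦ (2(d!)²L^d)⁻¹`, `L^{-d} ↦ (d!·L^d)⁻¹`, `hessCountAt ↦ symHessCountAt`,
  `[F′ = F] linCountAt ↦ [F′ = F] d!·symLinCountAt`, `linCountAt ↦ symLinCountAt` (an1's `symMjetAt_sref_of_ne_counts`, `symMjetAt_bref_self_counts`).
-/

namespace Summit.QuantumFields.BalabanUV.Beta.SymRootedMixedJetSingle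

open Literature.MathematicalPhysics.QuantumFieldTheory.Balaban1983to89
open Literature.MathematicalPhysics.QuantumFieldTheory.Balaban1983to89.Beta
open scoped Nat
open AffineAveraging (Form1)
open AveragingContoursRooted (ctr)
open AveragingHessianKernels (Bond single single_apply bw bw_single)
open Summit.QuantumFields.BalabanUV.Beta.SymAveragingHessianCounts (symLinU symHessUAt symLinCountAt symHessCountAt symLinU_single symHessUAt_single)
open AveragingThirdJet (Tau)
open AveragingThirdJet.Tau (ι)
open Summit.QuantumFields.BalabanUV.Beta.SymAveragingMixedJetTables (symMjetAt)
open ResolventReflection (sref bref bref_of_ne)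
open Summit.QuantumFields.BalabanUV.Beta.RootedHolonomyReflection (R1g)
open Summit.QuantumFields.BalabanUV.Beta.RootedMixedJetReflectionLaw (D1R D2R D12R)
open Summit.QuantumFields.BalabanUV.Beta.SymRootedMixedJetContact (symMjetAt_sref_of_ne_counts symMjetAt_bref_self_counts)
open RootedKernelReflection (fref fref_fst fref_injective)
open Summit.QuantumFields.BalabanUV.Beta.SymRootedMixedJetLinear (symMjetAt_neg_B)
open Summit.QuantumFields.BalabanUV.Beta.RootedMixedJetSigns (R1g_single)
open Summit.QuantumFields.BalabanUV.Beta.SymRootedMixedJetSigns (symMjetAt_neg_W symMjetAt_neg_V)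
open Summit.QuantumFields.BalabanUV.Beta.RootedMixedJetSingle (sym3 D1R_of_single D2R_of_single D12R_of_single single_neg ite_neg_eq_zsmul sym3_zsmul)

variable {𝕜 : Type*} [Field 𝕜] {d : ℕ} {𝔸 : Type*} [Ring 𝔸] [Algebra 𝕜 𝔸]

/-! ## §1 (the axis-correction components at single letters `D1R_of_single`∕`D2R_of_single`∕`D12R_of_single`: the comb module's, BY NAME) -/

/-! ## §2 The sym contact functionals at single letters, in sym counts -/

/-- [folklore] THE CONTACT FUNCTIONAL of 33M3b at single letters:
`s • (symHessUAt ρ (single F₁ u) (single F₂ x) + d! • symLinU ρ [single F₁ u, single F₂ x])`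
`= s • ((symHessCountAt F₁ F₂ + [F₁ = F₂]·d!·symLinCountAt F₁) • [u, x])` (node 7aρ's `symHessUAt_single`, `symLinU_single`, node 7a's
`bw_single`), written for a letter `x` guarded by a condition `P`. -/
theorem contact_single (ρ : Fin d → ℤ) (F₁ F₂ : Bond d) (u x : 𝔸) (P : Prop) [Decidable P] (s : 𝕜) (L : ℕ) (μ : Fin d)
    (y : Fin d → ℤ) :
    s • (symHessUAt ρ (single F₁ u) (single F₂ (if P then x else 0)) L μ y
          + (d ! : ℤ) • symLinU ρ (bw (single F₁ u) (single F₂ (if P then x else 0))) L μ y)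
      = if P then s • ((symHessCountAt ρ L μ y F₁ F₂ + (if F₁ = F₂ then (d ! : ℤ) * symLinCountAt ρ L μ y F₁ else 0))
          • AveragingHessianKernels.comm u x) else 0 := by
  rw [symHessUAt_single, bw_single, symLinU_single]
  by_cases hP : P
  · simp only [if_pos hP]
    by_cases h12 : F₁ = F₂
    · simp only [if_pos h12, add_smul, smul_smul]
    · simp only [if_neg h12, smul_zero, add_zero]
  · simp [hP]

/-- [folklore] `s • symLinU ρ (single F x) = s • (symLinCountAt F • x)`, written for a guarded letter. -/
theorem lin_single_ite (ρ : Fin d → ℤ) (F : Bond d) (x : 𝔸) (P : Prop) [Decidable P] (s : 𝕜) (L : ℕ) (μ : Fin d)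
    (y : Fin d → ℤ) :
    s • symLinU ρ (single F (if P then x else 0)) L μ y = if P then s • (symLinCountAt ρ L μ y F • x) else 0 := by
  rw [symLinU_single]
  split_ifs <;> simp

/-- [folklore] THE COMMUTATOR of 33M3b's longitudinal law at single letters:
`[s • symHessUAt ρ (single F a) (single F′ b), t • symLinU ρ (single G c)]`
`= (s t) • ((symHessCountAt F F′ · symLinCountAt G) • [[a, b], c])`. -/
theorem comm_hess_lin_single (ρ : Fin d → ℤ) (F F' G : Bond d) (a b c : 𝔸) (s t : 𝕜) (L : ℕ) (μ : Fin d) (y : Fin d → ℤ) :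
    AveragingHessianKernels.comm (s • symHessUAt ρ (single F a) (single F' b) L μ y) (t • symLinU ρ (single G c) L μ y)
      = (s * t) • ((symHessCountAt ρ L μ y F F' * symLinCountAt ρ L μ y G)
          • AveragingHessianKernels.comm (AveragingHessianKernels.comm a b) c) := by
  rw [symHessUAt_single, symLinU_single]
  set X := AveragingHessianKernels.comm a b
  simp only [AveragingHessianKernels.comm, smul_mul_smul_comm, smul_sub, mul_comm t s,
    mul_comm (symLinCountAt ρ L μ y G) (symHessCountAt ρ L μ y F F')]

/-! ## §3 Signs: the signed pull-back letters pull out of every term -/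

/-- [folklore] SIGNS PULL OUT OF THE MIXED JET AT SINGLE LETTERS (MX3's `symMjetAt_neg_W`, `symMjetAt_neg_V`, 33M1's `symMjetAt_neg_B`). -/
theorem symMjetAt_single_signs (ρ : Fin d → ℤ) (F F' G : Bond d) (a b c : 𝔸) (P Q R : Prop) [Decidable P] [Decidable Q]
    [Decidable R] (L : ℕ) (μ : Fin d) (y : Fin d → ℤ) :
    symMjetAt 𝕜 ρ (single F ((if P then -1 else 1 : ℤ) • a)) (single F' ((if Q then -1 else 1 : ℤ) • b))
        (single G ((if R then -1 else 1 : ℤ) • c)) L μ y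
      = ((if P then -1 else 1 : ℤ) * (if Q then -1 else 1 : ℤ) * (if R then -1 else 1 : ℤ))
          • symMjetAt 𝕜 ρ (single F a) (single F' b) (single G c) L μ y := by
  split_ifs <;> simp [single_neg, symMjetAt_neg_W, symMjetAt_neg_V, symMjetAt_neg_B]

/-! ## §4 The axis-reflection law of `symMjetAt` at single letters, every correction a count -/

section Law

variable {L : ℕ} (hL : Odd L) (h2 : (2 : 𝕜) ≠ 0) (hd : ((d ! : ℕ) : 𝕜) ≠ 0) (hL0 : (L : 𝕜) ≠ 0)
include hL h2 hd hL0

/-- [folklore] **THE AXIS-REFLECTION LAW OF NODE 12b's ROOTED MIXED JET AT SINGLE LETTERS, EVERY CORRECTION A COUNT.**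
For letters whose signed pull-backs are single-bond forms (`R1g α W = single F a`, `R1g α V = single F′ b`,
`R1g α B = single G c`; e.g. MX3's `R1g_single`), at the reflected block `(μ, bref α μ y)`:
`M(W,V;B) = ε_μ • ( M(single F a, single F′ b; single G c)(μ,y)`
`+ [F = G ∧ F on axis]·(2(d!)²L^d)⁻¹•((h(F′,F) + [F′=F] d!·q(F′))•[b,[c,a]])`
`+ [F′ = G ∧ F′ on axis]·(2(d!)²L^d)⁻¹•((h(F,F′) + [F=F′] d!·q(F))•[a,[c,b]])`
`+ [F = F′ = G on axis]·(d!·L^d)⁻¹•(q(F)•(½{a,b}c + c½{a,b} − acb − bca))`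
`+ [μ = α]·(2(d!)²L^d)⁻¹(d!·L^d)⁻¹•((h(F,F′)·q(G))•[[a,b],c]) )`, `ε_μ = −1` if `μ = α` else `1`, `h = symHessCountAt ρ_c`,
`q = symLinCountAt ρ_c` (an1's sym counts)
at `(μ, y)` — an1's sym twins of 33M3b's `symMjetAt_sref_of_ne_counts` (`μ ≠ α`, `bref = sref`) and `symMjetAt_bref_self_counts` (`μ = α`) with §1–§2. -/
theorem symMjetAt_bref_of_single (α μ : Fin d) {W V B : Form1 d 𝔸} {F F' G : Bond d} {a b c : 𝔸}
    (hW : R1g α W = single F a) (hV : R1g α V = single F' b) (hB : R1g α B = single G c) (y : Fin d → ℤ) :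
    symMjetAt 𝕜 (ctr d L) W V B L μ (bref α μ y)
      = (if μ = α then (-1 : ℤ) else 1) •
        (symMjetAt 𝕜 (ctr d L) (single F a) (single F' b) (single G c) L μ y
          + (if F = G ∧ F.1 = α then ((2 : 𝕜) * ((d ! : 𝕜) ^ 2 * (L : 𝕜) ^ d))⁻¹ •
              ((symHessCountAt (ctr d L) L μ y F' F + (if F' = F then (d ! : ℤ) * symLinCountAt (ctr d L) L μ y F' else 0))
                • AveragingHessianKernels.comm b (AveragingHessianKernels.comm c a)) else 0)
          + (if F' = G ∧ F'.1 = α then ((2 : 𝕜) * ((d ! : 𝕜) ^ 2 * (L : 𝕜) ^ d))⁻¹ •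
              ((symHessCountAt (ctr d L) L μ y F F' + (if F = F' then (d ! : ℤ) * symLinCountAt (ctr d L) L μ y F else 0))
                • AveragingHessianKernels.comm a (AveragingHessianKernels.comm c b)) else 0)
          + (if F = F' ∧ F' = G ∧ F.1 = α then ((d ! : 𝕜) * (L : 𝕜) ^ d)⁻¹ • (symLinCountAt (ctr d L) L μ y F • sym3 𝕜 a b c) else 0)
          + (if μ = α then (((2 : 𝕜) * ((d ! : 𝕜) ^ 2 * (L : 𝕜) ^ d))⁻¹ * ((d ! : 𝕜) * (L : 𝕜) ^ d)⁻¹) •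
              ((symHessCountAt (ctr d L) L μ y F F' * symLinCountAt (ctr d L) L μ y G)
                • AveragingHessianKernels.comm (AveragingHessianKernels.comm a b) c) else 0)) := by
  by_cases hμ : μ = α
  · subst hμ
    rw [symMjetAt_bref_self_counts hL h2 hd hL0, D1R_of_single hW hB, D2R_of_single hV hB, D12R_of_single hW hV hB, hW, hV, hB,
      contact_single, contact_single, lin_single_ite, comm_hess_lin_single, if_pos (rfl : μ = μ), if_pos (rfl : μ = μ),
      neg_one_zsmul]
  · rw [bref_of_ne hμ, symMjetAt_sref_of_ne_counts hL h2 hd hL0 hμ, D1R_of_single hW hB, D2R_of_single hV hB,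
      D12R_of_single hW hV hB, hW, hV, hB, contact_single, contact_single, lin_single_ite, if_neg hμ, if_neg hμ, one_zsmul,
      add_zero]

/-- [folklore] **THE SAME LAW FOR SINGLE LETTERS `W = single f a`, `V = single f′ b`, `B = single g c`, ALL SIGNS PULLED OUT**
(MX3's `R1g_single`: `F = fref α f`, the letter `±a`; §3): the global sign is `ε_μ · ε_f · ε_{f′} · ε_g`
(`ε_h = −1` iff the bond `h` lies on the axis `α`), the bracket is the bracket of `symMjetAt_bref_of_single` at the UNSIGNED letters
`a, b, c` on the reflected bonds `fref α f`, `fref α f′`, `fref α g` (conditions transported by `fref_injective`). -/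
theorem symMjetAt_single_bref (α μ : Fin d) (f f' g : Bond d) (a b c : 𝔸) (y : Fin d → ℤ) :
    symMjetAt 𝕜 (ctr d L) (single f a) (single f' b) (single g c) L μ (bref α μ y)
      = ((if μ = α then -1 else 1 : ℤ)
          * ((if f.1 = α then -1 else 1 : ℤ) * (if f'.1 = α then -1 else 1 : ℤ) * (if g.1 = α then -1 else 1 : ℤ))) •
        (symMjetAt 𝕜 (ctr d L) (single (fref α f) a) (single (fref α f') b) (single (fref α g) c) L μ y
          + (if f = g ∧ f.1 = α then ((2 : 𝕜) * ((d ! : 𝕜) ^ 2 * (L : 𝕜) ^ d))⁻¹ •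
              ((symHessCountAt (ctr d L) L μ y (fref α f') (fref α f)
                  + (if f' = f then (d ! : ℤ) * symLinCountAt (ctr d L) L μ y (fref α f') else 0))
                • AveragingHessianKernels.comm b (AveragingHessianKernels.comm c a)) else 0)
          + (if f' = g ∧ f'.1 = α then ((2 : 𝕜) * ((d ! : 𝕜) ^ 2 * (L : 𝕜) ^ d))⁻¹ •
              ((symHessCountAt (ctr d L) L μ y (fref α f) (fref α f')
                  + (if f = f' then (d ! : ℤ) * symLinCountAt (ctr d L) L μ y (fref α f) else 0))
                • AveragingHessianKernels.comm a (AveragingHessianKernels.comm c b)) else 0)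
          + (if f = f' ∧ f' = g ∧ f.1 = α then
              ((d ! : 𝕜) * (L : 𝕜) ^ d)⁻¹ • (symLinCountAt (ctr d L) L μ y (fref α f) • sym3 𝕜 a b c) else 0)
          + (if μ = α then (((2 : 𝕜) * ((d ! : 𝕜) ^ 2 * (L : 𝕜) ^ d))⁻¹ * ((d ! : 𝕜) * (L : 𝕜) ^ d)⁻¹) •
              ((symHessCountAt (ctr d L) L μ y (fref α f) (fref α f') * symLinCountAt (ctr d L) L μ y (fref α g))
                • AveragingHessianKernels.comm (AveragingHessianKernels.comm a b) c) else 0)) := by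
  have eW : R1g α (single f a) = single (fref α f) ((if f.1 = α then -1 else 1 : ℤ) • a) := by rw [R1g_single, ite_neg_eq_zsmul]
  have eV : R1g α (single f' b) = single (fref α f') ((if f'.1 = α then -1 else 1 : ℤ) • b) := by
    rw [R1g_single, ite_neg_eq_zsmul]
  have eB : R1g α (single g c) = single (fref α g) ((if g.1 = α then -1 else 1 : ℤ) • c) := by rw [R1g_single, ite_neg_eq_zsmul]
  rw [symMjetAt_bref_of_single hL h2 hd hL0 α μ eW eV eB,
    mul_smul (if μ = α then (-1 : ℤ) else 1) ((if f.1 = α then (-1 : ℤ) else 1) * (if f'.1 = α then (-1 : ℤ) else 1)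
      * (if g.1 = α then (-1 : ℤ) else 1))]
  congr 1
  simp only [symMjetAt_single_signs, AveragingHessianKernels.comm_zsmul_zsmul, sym3_zsmul, fref_fst, (fref_injective α).eq_iff,
    smul_add, smul_ite, smul_zero]
  generalize (if f.1 = α then -1 else 1 : ℤ) = z₁
  generalize (if f'.1 = α then -1 else 1 : ℤ) = z₂
  generalize (if g.1 = α then -1 else 1 : ℤ) = z₃
  congr 1
  · congr 1
    · congr 1
      · congr 1
        split_ifs <;> first | rfl | module
      · split_ifs <;> first | rfl | module
    · split_ifs <;> first | rfl | module
  · split_ifs <;> first | rfl | module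

end Law

end Summit.QuantumFields.BalabanUV.Beta.SymRootedMixedJetSingle
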